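import Summits.ResolutionOfSingularities.ResolutionOfSingularities.Theorems.WeightedInvariantIotaUpperSemicontinuousLE
import Mathlib.RingTheory.Spectrum.Prime.Chevalley
import Mathlib.RingTheory.Spectrum.Prime.ConstructibleSet
import Mathlib.RingTheory.Ideal.MinimalPrime.Noetherian
import HarnessLib

/-!
# Finiteness of the tie points, topological half: maximal points of closed sets, finitely many order values,
# and «a constructible subset of a curve missing its generic point is finite» (Chevalley side) — door
# `HypersurfaceCentreConstruction` (stmt-ResolutionOfSingularities-19897), route `WeightedInvariant`, P3 rung `KeyRungLE 3 p`

[OURS · L1 W4.3 · cell `res-hironaka`, HUMAN RULING D-0089] Helper file `--supports stmt-ResolutionOfSingularities-19897`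
(res-type-047, deliverable (D2) «FINITENESS OF THE TIE POINTS» of res-L1-w43-plan-1's RULING gen 11 #5 (2026-08-27T13:06:46Z,
route ruled: `T ∩ C = C ∩ π({b ∈ B₊ : ord_b g ≥ ν})` is constructible by Chevalley and misses the generic point of the curve
`C`, hence finite)).  This file is the TOPOLOGY: everything that does not mention the tie predicate, the cylinder move or
the Rees algebra.  CANDIDATE DESIGN OBJECTS ONLY; nothing here is a statement of the manuscript under review (Hironaka 2017,
[claim: Hironaka2017, status: under-review]); nothing is attributed to its author; nothing here claims anything about
resolution of singularities.  AI work, weaker than expert review.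

## What is proved (def-free)

* §1 `finite_setOf_isMaximalIn` — in a Noetherian quasi-sober space, the points of a closed set `F` that are MAXIMAL in
  `F` (no proper generization inside `F`) are finitely many (they are generic points of irreducible components of `F`);
  `finite_of_isClosed_of_forall_isClosed_singleton` — a closed set all of whose points are closed points is finite;
  `finite_closure_diff_of_isOpen` — for a point `η` all of whose proper specialisations are closed points and an open
  `V ∋ η`, `closure {η} ∖ V` is finite.
* §2 `exists_forall_eq_of_antitone_closeds` — on a Noetherian space a decreasing `ℕ`-chain of closed sets is eventually
  constant; `exists_forall_lt_of_isClosed_superlevel` — an `ℕ`-valued function with closed super-level sets `{n ≤ φ}`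
  on a Noetherian space is bounded (so an order function takes finitely many finite values).
* §3 `finite_basicConstructible_subset_zeroLocus`, `finite_of_isConstructible_subset_zeroLocus` — **for a Noetherian ring `A` and a prime `P` with
  `dim A/P ≤ 1` (every prime strictly above `P` is maximal), a CONSTRUCTIBLE subset of `V(P)` not containing `P` is
  finite**; `finite_image_comap_of_isConstructible` — Chevalley form: for `A → B` of finite presentation and a
  constructible `W ⊆ Spec B` all of whose points lie over `V(P)` and none over `P`, the set of primes of `A` under `W` is
  finite (Mathlib's `PrimeSpectrum.isConstructible_comap_image`).
* §4 `finite_of_subset_biUnion_closure` — the reduction: `T ⊆ ⋃_{η ∈ H} closure {η}` with `H` finite and, for each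
  `η ∈ H`, an open `V ∋ η` with `T ∩ closure {η} ∩ V` finite and `closure {η} ∖ V` finite ⇒ `T` finite.

## References

* res-L1-w43-plan-1, RULING gen 11 #5, `L/res-L1-w43-plan-1/IOTA3-DESIGN.md` v1.3.1 §8.5/§9.3 (OURS, AI planning).
* The Stacks Project, Tag 00F8 / 054K (Chevalley's theorem; constructible sets). [StacksProject]
-/

noncomputable section

set_option linter.dupNamespace false -- mandated namespace `Summit.<Summit>.<Problem>` of this single-conjunct summit

open CategoryTheory AlgebraicGeometry TopologicalSpace Topology

namespace Summit.ResolutionOfSingularities.ResolutionOfSingularities.Cruxes.HypersurfaceCentreConstruction.LocalEngine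

namespace TieFinite

/-! ## §1 Maximal points of closed sets in Noetherian quasi-sober spaces -/

section MaximalPoints

variable {X : Type*} [TopologicalSpace X]

/-- If `y` is maximal in the closed set `F` (every point of `F` specialising to `y` equals `y`), then every irreducible
subset of `F` containing `y` lies in `closure {y}` (quasi-sober ambient). [folklore] -/
theorem subset_closure_singleton_of_isMaximalIn [QuasiSober X] {F : Set X} (hF : IsClosed F) {y : X}
    (hmax : ∀ y' ∈ F, y' ⤳ y → y' = y) {s : Set X} (hs : IsIrreducible s) (hsF : s ⊆ F) (hys : y ∈ s) :
    s ⊆ closure {y} := by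
  set ξ := hs.genericPoint with hξ
  have hspec : IsGenericPoint ξ (closure s) := hs.isGenericPoint_genericPoint_closure
  -- `ξ ⤳ y` since `y ∈ closure s = closure {ξ}`
  have hξy : ξ ⤳ y := hspec.specializes (subset_closure hys)
  have hξF : ξ ∈ F := (hF.closure_subset_iff.mpr hsF) hspec.mem
  have hξeq : ξ = y := hmax ξ hξF hξy
  calc s ⊆ closure s := subset_closure
    _ = closure {ξ} := hspec.def.symm
    _ = closure {y} := by rw [hξeq]

/-- **The maximal points of a closed set are finitely many** (Noetherian quasi-sober space): `y ↦ closure {y} ∩ F`, read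
in the subspace `F`, sends them injectively to irreducible components of `F`. [folklore] -/
theorem finite_setOf_isMaximalIn [NoetherianSpace X] [QuasiSober X] [T0Space X] {F : Set X} (hF : IsClosed F) :
    {y : X | y ∈ F ∧ ∀ y' ∈ F, y' ⤳ y → y' = y}.Finite := by
  -- the irreducible components of the Noetherian subspace `F`
  haveI : NoetherianSpace F := inferInstance
  have hfin : (irreducibleComponents F).Finite := NoetherianSpace.finite_irreducibleComponents
  -- the map `y ↦ closure {⟨y, _⟩}` (closure in the subspace)
  let φ : {y : X | y ∈ F ∧ ∀ y' ∈ F, y' ⤳ y → y' = y} → irreducibleComponents F := fun y =>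
    ⟨closure {(⟨y.1, y.2.1⟩ : F)}, by
      refine ⟨isIrreducible_singleton.closure, ?_⟩
      intro s hs hle
      -- `s` irreducible in the subspace, containing `closure {y}`; its image is irreducible in `X`, inside `F`
      have hys : (⟨y.1, y.2.1⟩ : F) ∈ s := hle (subset_closure rfl)
      have himg : IsIrreducible (Subtype.val '' s) := hs.image _ continuous_subtype_val.continuousOn
      have hsub := subset_closure_singleton_of_isMaximalIn hF y.2.2 himg
        (by rintro _ ⟨z, _, rfl⟩; exact z.2) ⟨_, hys, rfl⟩
      -- back to the subspace: `s ⊆ closure {y}`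
      intro z hz
      have hz' : (z : X) ∈ closure {(y.1 : X)} := hsub ⟨z, hz, rfl⟩
      rw [IsEmbedding.subtypeVal.closure_eq_preimage_closure_image, Set.image_singleton]
      exact hz'⟩
  have hinj : Function.Injective φ := by
    intro a b hab
    have h1 : closure {(⟨a.1, a.2.1⟩ : F)} = closure {(⟨b.1, b.2.1⟩ : F)} := congrArg Subtype.val hab
    have h2 : Inseparable (⟨a.1, a.2.1⟩ : F) ⟨b.1, b.2.1⟩ := by
      rw [inseparable_iff_closure_eq, h1]
    have h3 : (⟨a.1, a.2.1⟩ : F) = ⟨b.1, b.2.1⟩ := h2.eq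
    exact Subtype.ext (congrArg (fun z : F => (z : X)) h3)
  haveI : Finite (irreducibleComponents F) := hfin.to_subtype
  exact Set.finite_coe_iff.mp (Finite.of_injective φ hinj)

/-- **A closed set all of whose points are closed points is finite** (Noetherian quasi-sober space): all its points are
maximal in it. [folklore] -/
theorem finite_of_isClosed_of_forall_isClosed_singleton [NoetherianSpace X] [QuasiSober X] [T0Space X] {K : Set X}
    (hK : IsClosed K) (hpts : ∀ y ∈ K, IsClosed ({y} : Set X)) : K.Finite := by
  refine (finite_setOf_isMaximalIn hK).subset fun y hy => ⟨hy, fun y' hy' hsp => ?_⟩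
  -- `y' ⤳ y` with `y'` a closed point forces `y = y'`
  have h := hsp.mem_closed (hpts y' hy') (Set.mem_singleton y')
  exact (Set.mem_singleton_iff.mp h).symm

/-- **`closure {η} ∖ V` is finite** for an open `V ∋ η` when every point of `closure {η}` other than `η` is a closed point
(e.g. `η` of codimension `1` below the top dimension). [folklore] -/
theorem finite_closure_diff_of_isOpen [NoetherianSpace X] [QuasiSober X] [T0Space X] {η : X} {V : Set X}
    (hV : IsOpen V) (hηV : η ∈ V) (hpts : ∀ y ∈ closure ({η} : Set X), y ≠ η → IsClosed ({y} : Set X)) :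
    (closure {η} \ V).Finite := by
  refine finite_of_isClosed_of_forall_isClosed_singleton (isClosed_closure.sdiff hV) fun y hy => hpts y hy.1 ?_
  rintro rfl
  exact hy.2 hηV

end MaximalPoints

/-! ## §2 Finitely many values of a function with closed super-level sets -/

section Values

variable {X : Type*} [TopologicalSpace X]

/-- On a Noetherian space a decreasing `ℕ`-indexed chain of closed sets is eventually constant. [folklore] -/
theorem exists_forall_eq_of_antitone_closeds [NoetherianSpace X] (F : ℕ → Set X) (hF : ∀ n, IsClosed (F n))
    (hanti : ∀ n, F (n + 1) ⊆ F n) : ∃ N, ∀ n, N ≤ n → F n = F N := by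
  -- the chain in `(Closeds X)ᵒᵈ`, where `>` is well-founded (`WellFoundedLT (Closeds X)`)
  let G : ℕ →o (Closeds X)ᵒᵈ :=
    ⟨fun n => OrderDual.toDual ⟨F n, hF n⟩, fun m n hmn => by
      change (⟨F n, hF n⟩ : Closeds X) ≤ ⟨F m, hF m⟩
      induction hmn with
      | refl => exact le_rfl
      | step _ ih => exact (hanti _).trans ih⟩
  obtain ⟨N, hN⟩ := WellFoundedGT.monotone_chain_condition G
  refine ⟨N, fun n hn => ?_⟩
  have h := hN n hn
  have h' : (⟨F N, hF N⟩ : Closeds X) = ⟨F n, hF n⟩ := congrArg OrderDual.ofDual h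
  exact (congrArg (fun C : Closeds X => (C : Set X)) h').symm

/-- **An `ℕ∞`-free form of «finitely many values»**: if `φ : X → ℕ` has CLOSED super-level sets `{x | n ≤ φ x}` on a
Noetherian space, then `φ` is bounded. [folklore] -/
theorem exists_forall_lt_of_isClosed_superlevel [NoetherianSpace X] (φ : X → ℕ)
    (hφ : ∀ n : ℕ, IsClosed {x : X | n ≤ φ x}) : ∃ N : ℕ, ∀ x, φ x < N := by
  obtain ⟨N, hN⟩ := exists_forall_eq_of_antitone_closeds (fun n => {x : X | n ≤ φ x}) hφ
    (fun n x hx => (Nat.le_succ n).trans hx)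
  refine ⟨N, fun x => ?_⟩
  by_contra h
  have hNx : N ≤ φ x := Nat.le_of_not_lt h
  -- `x ∈ F_{φ x} = F_N = F_{φ x + 1}`: contradiction
  have hx : x ∈ {y : X | φ x ≤ φ y} := le_refl (φ x)
  rw [hN (φ x) hNx, ← hN (φ x + 1) (hNx.trans (Nat.le_succ _))] at hx
  exact absurd (show φ x + 1 ≤ φ x from hx) (by omega)

end Values

/-! ## §3 Constructible subsets of a curve missing the generic point -/

section Curve

variable {A : Type*} [CommRing A]

/-- A basic constructible set `V(g₁,…,gₙ) ∖ V(f)` inside `V(P)` and missing `P` is finite when every prime strictly above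
`P` is maximal (`A` Noetherian): if all `gᵢ ∈ P` then `f ∈ P ⊆ 𝔮` for each of its points `𝔮`, so it is empty; otherwise
its points are primes above `P + (gⱼ)` for some `gⱼ ∉ P`, all maximal, hence minimal over `P + (gⱼ)`: finitely many.
[folklore] -/
theorem finite_basicConstructible_subset_zeroLocus [IsNoetherianRing A] (P : Ideal A) [hP : P.IsPrime]
    (hdim : ∀ 𝔮 : Ideal A, 𝔮.IsPrime → P < 𝔮 → 𝔮.IsMaximal)
    (C : PrimeSpectrum.BasicConstructibleSetData A) (hCZ : C.toSet ⊆ PrimeSpectrum.zeroLocus (P : Set A))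
    (hPC : (⟨P, hP⟩ : PrimeSpectrum A) ∉ C.toSet) : C.toSet.Finite := by
  classical
  -- membership in the basic set
  have hmem : ∀ 𝔮 : PrimeSpectrum A, 𝔮 ∈ C.toSet ↔ (∀ i, C.g i ∈ 𝔮.asIdeal) ∧ C.f ∉ 𝔮.asIdeal := by
    intro 𝔮
    simp only [PrimeSpectrum.BasicConstructibleSetData.toSet, Set.mem_sdiff, PrimeSpectrum.mem_zeroLocus,
      Set.range_subset_iff, SetLike.mem_coe, Set.singleton_subset_iff]
  have hPle : ∀ 𝔮 ∈ C.toSet, P ≤ 𝔮.asIdeal := fun 𝔮 h𝔮 a ha => hCZ h𝔮 ha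
  by_cases hg : ∀ i, C.g i ∈ P
  · -- then `f ∈ P` and the set is empty
    have hfP : C.f ∈ P := by
      by_contra hf
      exact hPC ((hmem ⟨P, hP⟩).mpr ⟨hg, hf⟩)
    have hempty : C.toSet = ∅ := by
      ext 𝔮
      simp only [Set.mem_empty_iff_false, iff_false]
      intro h𝔮
      exact ((hmem 𝔮).mp h𝔮).2 (hPle 𝔮 h𝔮 hfP)
    rw [hempty]; exact Set.finite_empty
  · push Not at hg
    obtain ⟨j, hj⟩ := hg
    set J : Ideal A := P ⊔ Ideal.span {C.g j} with hJ
    have hPJ : P < J := by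
      refine lt_of_le_of_ne le_sup_left fun h => hj ?_
      rw [h]; exact Ideal.mem_sup_right (Ideal.subset_span rfl)
    have hfinJ : (J.minimalPrimes).Finite := Ideal.finite_minimalPrimes_of_isNoetherianRing A J
    refine Set.Finite.of_injOn (f := fun 𝔮 : PrimeSpectrum A => 𝔮.asIdeal) (fun 𝔮 h𝔮 => ?_)
      (fun a _ b _ h => PrimeSpectrum.ext h) hfinJ
    -- `𝔮 ⊇ J`, `𝔮` is maximal, hence a minimal prime of `J`
    have hJ𝔮 : J ≤ 𝔮.asIdeal :=
      sup_le (hPle 𝔮 h𝔮) ((Ideal.span_singleton_le_iff_mem 𝔮.asIdeal).mpr (((hmem 𝔮).mp h𝔮).1 j))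
    have hmax : 𝔮.asIdeal.IsMaximal := hdim _ 𝔮.isPrime (hPJ.trans_le hJ𝔮)
    refine ⟨⟨𝔮.isPrime, hJ𝔮⟩, fun q hq hq𝔮 => ?_⟩
    have hqmax : q.IsMaximal := hdim q hq.1 (hPJ.trans_le hq.2)
    exact (hqmax.eq_of_le hmax.ne_top hq𝔮).ge

/-- **A constructible subset of `V(P)` missing `P` is finite**, for `A` Noetherian and `P` a prime such that every prime
strictly above `P` is maximal (`dim A/P ≤ 1`). [folklore] -/
theorem finite_of_isConstructible_subset_zeroLocus [IsNoetherianRing A] (P : Ideal A) [hP : P.IsPrime]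
    (hdim : ∀ 𝔮 : Ideal A, 𝔮.IsPrime → P < 𝔮 → 𝔮.IsMaximal)
    {Z : Set (PrimeSpectrum A)} (hZ : IsConstructible Z) (hZP : Z ⊆ PrimeSpectrum.zeroLocus (P : Set A))
    (hPZ : (⟨P, hP⟩ : PrimeSpectrum A) ∉ Z) : Z.Finite := by
  classical
  obtain ⟨S, rfl⟩ := PrimeSpectrum.exists_constructibleSetData_iff.mpr hZ
  refine Set.Finite.biUnion S.finite_toSet fun C hC => ?_
  exact finite_basicConstructible_subset_zeroLocus P hdim C (fun 𝔮 h𝔮 => hZP (Set.mem_biUnion hC h𝔮))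
    (fun h => hPZ (Set.mem_biUnion hC h))

/-- **Chevalley form.**  For a ring map `φ : A → B` of finite presentation, a constructible `W ⊆ Spec B` all of whose
points lie over `V(P)` and none over `P` (`A` Noetherian, every prime strictly above `P` maximal): the set of primes of `A`
lying under a point of `W` is finite (`PrimeSpectrum.isConstructible_comap_image`). [folklore] -/
theorem finite_image_comap_of_isConstructible [IsNoetherianRing A] {B : Type*} [CommRing B] (φ : A →+* B)
    (hφ : φ.FinitePresentation) (P : Ideal A) [hP : P.IsPrime]
    (hdim : ∀ 𝔮 : Ideal A, 𝔮.IsPrime → P < 𝔮 → 𝔮.IsMaximal)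
    {W : Set (PrimeSpectrum B)} (hW : IsConstructible W)
    (hWP : ∀ 𝔫 ∈ W, P ≤ (PrimeSpectrum.comap φ 𝔫).asIdeal)
    (hWη : ∀ 𝔫 ∈ W, (PrimeSpectrum.comap φ 𝔫).asIdeal ≠ P) :
    (PrimeSpectrum.comap φ '' W).Finite := by
  refine finite_of_isConstructible_subset_zeroLocus P hdim (PrimeSpectrum.isConstructible_comap_image hφ hW) ?_ ?_
  · rintro _ ⟨𝔫, h𝔫, rfl⟩ a ha
    exact hWP 𝔫 h𝔫 ha
  · rintro ⟨𝔫, h𝔫, h⟩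
    exact hWη 𝔫 h𝔫 (congrArg PrimeSpectrum.asIdeal h)

end Curve

/-! ## §4 The reduction to finitely many curves -/

section Reduction

variable {X : Type*} [TopologicalSpace X]

/-- **Reduction.**  If `T ⊆ ⋃_{η ∈ H} closure {η}` with `H` finite, and for every `η ∈ H` there is an open `V ∋ η` with
`T ∩ closure {η} ∩ V` finite and `closure {η} ∖ V` finite, then `T` is finite. [folklore] -/
theorem finite_of_subset_biUnion_closure {T H : Set X} (hH : H.Finite) (hT : T ⊆ ⋃ η ∈ H, closure {η})
    (hloc : ∀ η ∈ H, ∃ V : Set X, IsOpen V ∧ η ∈ V ∧ (T ∩ closure {η} ∩ V).Finite ∧ (closure {η} \ V).Finite) :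
    T.Finite := by
  have hcover : T ⊆ ⋃ η ∈ H, (T ∩ closure {η}) := by
    intro t ht
    obtain ⟨η, hη, htη⟩ := Set.mem_iUnion₂.mp (hT ht)
    exact Set.mem_biUnion hη ⟨ht, htη⟩
  refine (hH.biUnion fun η hη => ?_).subset hcover
  obtain ⟨V, -, -, h1, h2⟩ := hloc η hη
  refine (h1.union h2).subset ?_
  rintro t ⟨ht, htη⟩
  by_cases htV : t ∈ V
  · exact Or.inl ⟨⟨ht, htη⟩, htV⟩
  · exact Or.inr ⟨htη, htV⟩

end Reduction

end TieFinite

end Summit.ResolutionOfSingularities.ResolutionOfSingularities.Cruxes.HypersurfaceCentreConstruction.LocalEngine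

end
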